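import Summits.Schanuel.Schanuel.Theorems.SoloInformedRoyNoExactZeros
import Literature.NumberTheory.Transcendental.RoyCriterionProp2Proofs

/-!
# Roy's criterion: condition (b) is never witnessed by exact zeros

Condition (b) of Roy's Theorem 1 / the hypothesis of Conjecture 2 (Roy 2001) asks, for each large
`N`, for a non-zero `Q_N ∈ ℤ[X₀, X₁]` of partial degrees `≤ (N^{t₀}, N^{t₁})` and height `≤ e^N`
whose values `(D^k Q_N)(my, α^m)` (`D = ∂₀ + X₁∂₁ = royD`, `k ≤ N^{s₀}`, `m ≤ N^{s₁}`) are SMALL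
(`≤ e^{-N^u}`). Above the "Dirichlet line" `s₀ + s₁ > t₀ + t₁` these values can never all be
ZERO — for any point `(y, α)` with `y ≠ 0` (and `α` not a root of unity, or `t₁ < s₀`), for any
height, for every large `N` (asymptotic form of `roy_no_exact_zeros` of
`SoloInformedRoyNoExactZeros`, Philippon's zero estimate on `𝔾ₐ × 𝔾ₘ`):

* `roy_no_exact_witness`: for `0 ≤ t₀, t₁`, `t₀ + t₁ < s₀ + s₁` and (`α` non-torsion or
  `t₁ < s₀`): for all large `N`, every non-zero `Q` of bidegree `≤ (N^{t₀}, N^{t₁})` has a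
  non-zero value `(D^k Q)(my, α^m)`, `k ≤ N^{s₀}`, `m ≤ N^{s₁}`;
* `roy_no_exact_witness_of_admissible`: in particular throughout Roy's window (1), at every point;
* `royConditionB_inexact`: so wherever (b) holds its witnesses `Q_N` are irreducibly APPROXIMATE —
  some value in the box is non-zero of modulus `≤ e^{-N^u}`;
* `royConditionB_graph_inexact`: e.g. on the graph `α = e^y`, `y ≠ 0`, where (b) holds by Roy's
  Proposition 2 (Waldschmidt's auxiliary polynomials; PROVED in the tree, `Roy2001_prop2_holds`).

Meaning for Schanuel (solo-informed atlas §3, S2): the hypothesis of Conjecture 2 is a statement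
of diophantine APPROXIMATION which provably has no exact (algebraic-geometric) instances; every
use of it must convert "small" into structure. At algebraic points Liouville's inequality
converts small into zero, so (b) fails there (the direct method; transcendence degree 0); Roy's
Theorem 1 converts small into "`α e^{-y}` is torsion" through interpolation, at the price
`s₀ > 1`; in rank `l ≥ 2` no conversion is known in the over-determined regime
`s₀ + s₁ > t₀ + t₁` where Conjecture 2 lives (Roy 2013, p. 5: "its main limitation lies in the
fact that ... the number of conditions ... needs to be less than the dimension of the space of
polynomials").

References: D. Roy, *An arithmetic criterion for the values of the exponential function*, Acta
Arith. 97 (2001) 183–194, Thm. 1, Prop. 2 [Roy2001]; P. Philippon, *Lemmes de zéros dans les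
groupes algébriques commutatifs*, Bull. SMF 114 (1986), Thm. 2.1 [Philippon1986]; N. A. V. Nguyen,
D. Roy, IJNT 12 (2016), proof of Cor. 2 [NguyenRoy2016]; D. Roy, Mathematika 59 (2013), p. 5
[Roy2013].
-/

noncomputable section

open MvPolynomial Filter Complex
open Literature.NumberTheory.Transcendental
open Literature.NumberTheory.Transcendental.Baker1975.Ch3 (philC)

namespace Summit.Schanuel.Schanuel.Theorems

/-! ### Roy's normalisation -/

/-- `x/2 < ⌊⌊x⌋₊/2⌋ + 1`. [folklore] -/
theorem real_half_lt_natFloor_div_two_add_one (x : ℝ) : x / 2 < ((⌊x⌋₊ / 2 : ℕ) : ℝ) + 1 := by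
  have h1 : x < (⌊x⌋₊ : ℝ) + 1 := Nat.lt_floor_add_one x
  have h2 : (⌊x⌋₊ : ℝ) + 1 ≤ 2 * (((⌊x⌋₊ / 2 : ℕ) : ℝ) + 1) := by
    have : ⌊x⌋₊ + 1 ≤ 2 * (⌊x⌋₊ / 2 + 1) := by omega
    exact_mod_cast this
  linarith

/-- `max(1, ⌊N^t⌋) ≤ N^t` for `N ≥ 1`, `t ≥ 0`. [folklore] -/
theorem cast_max_one_natFloor_rpow_le {N : ℕ} (hN : 1 ≤ N) {t : ℝ} (ht : 0 ≤ t) :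
    ((max 1 ⌊(N : ℝ) ^ t⌋₊ : ℕ) : ℝ) ≤ (N : ℝ) ^ t := by
  have h1 : (1 : ℝ) ≤ (N : ℝ) ^ t := Real.one_le_rpow (by exact_mod_cast hN) ht
  rw [Nat.cast_max, Nat.cast_one]
  exact max_le h1 (Nat.floor_le (by positivity))

/-- **Condition (b) is never witnessed by exact zeros above the Dirichlet line.** Let `y ≠ 0`,
`α ≠ 0`, `0 ≤ t₀, t₁`, `t₀ + t₁ < s₀ + s₁`, and assume `α` is not a root of unity or `t₁ < s₀`.
Then for every sufficiently large `N`, every non-zero `Q ∈ ℤ[X₀, X₁]` with `deg_{X₀} Q ≤ N^{t₀}`,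
`deg_{X₁} Q ≤ N^{t₁}` (no height condition) has `(D^k Q)(my, α^m) ≠ 0` for some `k ≤ N^{s₀}`,
`m ≤ N^{s₁}`. [cite: Philippon1986, Thm. 2.1; Roy2001, Thm. 1 (b)] -/
theorem roy_no_exact_witness {y α : ℂ} (hy : y ≠ 0) (hα : α ≠ 0) {s₀ s₁ t₀ t₁ : ℝ}
    (ht₀ : 0 ≤ t₀) (ht₁ : 0 ≤ t₁) (hsum : t₀ + t₁ < s₀ + s₁)
    (htor : (∀ d : ℕ, 1 ≤ d → α ^ d ≠ 1) ∨ t₁ < s₀) :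
    ∀ᶠ N : ℕ in atTop, ∀ Q : MvPolynomial (Fin 2) ℤ, Q ≠ 0 →
      (Q.degreeOf 0 : ℝ) ≤ (N : ℝ) ^ t₀ → (Q.degreeOf 1 : ℝ) ≤ (N : ℝ) ^ t₁ →
      ∃ k m : ℕ, (k : ℝ) ≤ (N : ℝ) ^ s₀ ∧ (m : ℝ) ≤ (N : ℝ) ^ s₁ ∧
        aeval ![(m : ℂ) * y, α ^ m] (royD^[k] Q) ≠ 0 := by
  have E1 : ∀ᶠ N : ℕ in atTop,
      (philC 1 : ℝ) * (N : ℝ) ^ (t₀ + t₁) ≤ (1 / 8) * (N : ℝ) ^ (s₀ + s₁) :=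
    tendsto_natCast_atTop_atTop.eventually
      (eventually_mul_rpow_le_mul_rpow (philC 1 : ℝ) hsum (by norm_num))
  have E2 : ∀ᶠ N : ℕ in atTop,
      t₁ < s₀ → (philC 1 : ℝ) * (N : ℝ) ^ t₁ ≤ (1 / 4) * (N : ℝ) ^ s₀ := by
    rcases lt_or_ge t₁ s₀ with h | h
    · filter_upwards [tendsto_natCast_atTop_atTop.eventually
        (eventually_mul_rpow_le_mul_rpow (philC 1 : ℝ) h (by norm_num : (0 : ℝ) < 1 / 4))]
        with N hN _ using hN
    · exact Eventually.of_forall fun N hlt => absurd hlt (not_lt.mpr h)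
  filter_upwards [E1, E2, eventually_ge_atTop 1] with N hE1 hE2 hN1 Q hQ hd0 hd1
  have hN0 : (0 : ℝ) < N := by exact_mod_cast hN1
  set K := ⌊(N : ℝ) ^ s₀⌋₊ with hK
  set M := ⌊(N : ℝ) ^ s₁⌋₊ with hM
  set T₀ := ⌊(N : ℝ) ^ t₀⌋₊ with hT₀
  set T₁ := ⌊(N : ℝ) ^ t₁⌋₊ with hT₁
  have hQ0 : Q.degreeOf 0 ≤ T₀ := Nat.le_floor hd0
  have hQ1 : Q.degreeOf 1 ≤ T₁ := Nat.le_floor hd1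
  have hK2 : (N : ℝ) ^ s₀ / 2 < ((K / 2 : ℕ) : ℝ) + 1 := real_half_lt_natFloor_div_two_add_one _
  have hM2 : (N : ℝ) ^ s₁ / 2 < ((M / 2 : ℕ) : ℝ) + 1 := real_half_lt_natFloor_div_two_add_one _
  have hT₀le : ((max 1 T₀ : ℕ) : ℝ) ≤ (N : ℝ) ^ t₀ := cast_max_one_natFloor_rpow_le hN1 ht₀
  have hT₁le : ((max 1 T₁ : ℕ) : ℝ) ≤ (N : ℝ) ^ t₁ := cast_max_one_natFloor_rpow_le hN1 ht₁
  have hs0 : (0 : ℝ) < (N : ℝ) ^ s₀ := Real.rpow_pos_of_pos hN0 _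
  have hs1 : (0 : ℝ) < (N : ℝ) ^ s₁ := Real.rpow_pos_of_pos hN0 _
  have hc0 : (0 : ℝ) ≤ (philC 1 : ℝ) := Nat.cast_nonneg _
  have hcount : philC 1 * max 1 T₀ * max 1 T₁ < (K / 2 + 1) * (M / 2 + 1) := by
    have key : ((philC 1 * max 1 T₀ * max 1 T₁ : ℕ) : ℝ) <
        (((K / 2 + 1) * (M / 2 + 1) : ℕ) : ℝ) := by
      have lhs : ((philC 1 * max 1 T₀ * max 1 T₁ : ℕ) : ℝ) ≤
          (philC 1 : ℝ) * (N : ℝ) ^ (t₀ + t₁) := by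
        rw [Nat.cast_mul, Nat.cast_mul, Real.rpow_add hN0, ← mul_assoc]
        gcongr
      have hprod := mul_lt_mul'' hK2 hM2 (by positivity) (by positivity)
      have e : (N : ℝ) ^ s₀ / 2 * ((N : ℝ) ^ s₁ / 2) = (N : ℝ) ^ (s₀ + s₁) / 4 := by
        rw [Real.rpow_add hN0]; ring
      have rhs : (N : ℝ) ^ (s₀ + s₁) / 4 < (((K / 2 + 1) * (M / 2 + 1) : ℕ) : ℝ) := by
        push_cast
        linarith
      have hpos : (0 : ℝ) < (N : ℝ) ^ (s₀ + s₁) := Real.rpow_pos_of_pos hN0 _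
      linarith
    exact_mod_cast key
  have htor' : (∀ d : ℕ, 1 ≤ d → α ^ d ≠ 1) ∨ philC 1 * max 1 T₁ < K / 2 + 1 := by
    rcases htor with h | h
    · exact Or.inl h
    · right
      have key : ((philC 1 * max 1 T₁ : ℕ) : ℝ) < ((K / 2 + 1 : ℕ) : ℝ) := by
        have lhs : ((philC 1 * max 1 T₁ : ℕ) : ℝ) ≤ (philC 1 : ℝ) * (N : ℝ) ^ t₁ := by
          rw [Nat.cast_mul]; gcongr
        have h4 := hE2 h
        have rhs : (N : ℝ) ^ s₀ / 2 < ((K / 2 + 1 : ℕ) : ℝ) := by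
          push_cast
          linarith
        linarith
      exact_mod_cast key
  obtain ⟨k, m, hk, hm, hne⟩ := roy_no_exact_zeros hy hα hcount htor' Q hQ hQ0 hQ1
  exact ⟨k, m, (Nat.cast_le.mpr hk).trans (Nat.floor_le hs0.le),
    (Nat.cast_le.mpr hm).trans (Nat.floor_le hs1.le), hne⟩

/-- **In Roy's window (1) there are no exact witnesses of (b)**, for every `(y, α)` with `y ≠ 0`,
`α ≠ 0` (window (1) gives `0 < t₁ < 2t₁ < s₀`, `t₀ < s₀`, `t₁ < s₁`).
[cite: Roy2001, Thm. 1 and (1)] -/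
theorem roy_no_exact_witness_of_admissible {y α : ℂ} (hy : y ≠ 0) (hα : α ≠ 0)
    {s₀ s₁ t₀ t₁ u : ℝ} (h : RoyAdmissible s₀ s₁ t₀ t₁ u) :
    ∀ᶠ N : ℕ in atTop, ∀ Q : MvPolynomial (Fin 2) ℤ, Q ≠ 0 →
      (Q.degreeOf 0 : ℝ) ≤ (N : ℝ) ^ t₀ → (Q.degreeOf 1 : ℝ) ≤ (N : ℝ) ^ t₁ →
      ∃ k m : ℕ, (k : ℝ) ≤ (N : ℝ) ^ s₀ ∧ (m : ℝ) ≤ (N : ℝ) ^ s₁ ∧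
        aeval ![(m : ℂ) * y, α ^ m] (royD^[k] Q) ≠ 0 := by
  obtain ⟨hs₀, hs₁, ht₀, ht₁, hu, hmax, hmin, _⟩ := h
  have h1 : t₀ < s₀ := lt_of_le_of_lt (le_max_of_le_right (le_max_left _ _))
    (hmax.trans_le (min_le_left _ _))
  have h2 : 2 * t₁ < 2 * s₁ := lt_of_le_of_lt (le_max_of_le_right (le_max_right _ _))
    (hmax.trans_le (min_le_right _ _))
  have h3 : 2 * t₁ < s₀ := lt_of_le_of_lt (le_max_of_le_right (le_max_right _ _))
    (hmax.trans_le (min_le_left _ _))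
  exact roy_no_exact_witness hy hα ht₀.le ht₁.le (by linarith) (Or.inr (by linarith))

/-- **The witnesses of (b) are irreducibly approximate.** If (b) holds at `(y, α)`, `y ≠ 0`,
`α ≠ 0`, with `0 ≤ t₀, t₁`, `t₀ + t₁ < s₀ + s₁` and (`α` non-torsion or `t₁ < s₀`), then for all
large `N` there is a witness `Q_N` (bidegree `≤ (N^{t₀}, N^{t₁})`, height `≤ e^N`, all values in the
box `≤ e^{-N^u}`) and EVERY such witness has a value `(D^k Q_N)(my, α^m)`, `k ≤ N^{s₀}`,
`m ≤ N^{s₁}`, with `0 < |(D^k Q_N)(my, α^m)| ≤ e^{-N^u}`.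
[cite: Roy2001, Thm. 1 (b); Philippon1986, Thm. 2.1] -/
theorem royConditionB_inexact {y α : ℂ} (hy : y ≠ 0) (hα : α ≠ 0) {s₀ s₁ t₀ t₁ u : ℝ}
    (ht₀ : 0 ≤ t₀) (ht₁ : 0 ≤ t₁) (hsum : t₀ + t₁ < s₀ + s₁)
    (htor : (∀ d : ℕ, 1 ≤ d → α ^ d ≠ 1) ∨ t₁ < s₀) (hb : RoyConditionB y α s₀ s₁ t₀ t₁ u) :
    ∀ᶠ N : ℕ in atTop,
      (∃ Q : MvPolynomial (Fin 2) ℤ, Q ≠ 0 ∧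
        (Q.degreeOf 0 : ℝ) ≤ (N : ℝ) ^ t₀ ∧ (Q.degreeOf 1 : ℝ) ≤ (N : ℝ) ^ t₁ ∧
        (mvPolyHeight Q : ℝ) ≤ Real.exp N ∧
        ∀ k m : ℕ, (k : ℝ) ≤ (N : ℝ) ^ s₀ → (m : ℝ) ≤ (N : ℝ) ^ s₁ →
          ‖aeval ![(m : ℂ) * y, α ^ m] (royD^[k] Q)‖ ≤ Real.exp (-(N : ℝ) ^ u)) ∧
      ∀ Q : MvPolynomial (Fin 2) ℤ, Q ≠ 0 →
        (Q.degreeOf 0 : ℝ) ≤ (N : ℝ) ^ t₀ → (Q.degreeOf 1 : ℝ) ≤ (N : ℝ) ^ t₁ →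
        (∀ k m : ℕ, (k : ℝ) ≤ (N : ℝ) ^ s₀ → (m : ℝ) ≤ (N : ℝ) ^ s₁ →
          ‖aeval ![(m : ℂ) * y, α ^ m] (royD^[k] Q)‖ ≤ Real.exp (-(N : ℝ) ^ u)) →
        ∃ k m : ℕ, (k : ℝ) ≤ (N : ℝ) ^ s₀ ∧ (m : ℝ) ≤ (N : ℝ) ^ s₁ ∧
          0 < ‖aeval ![(m : ℂ) * y, α ^ m] (royD^[k] Q)‖ ∧
          ‖aeval ![(m : ℂ) * y, α ^ m] (royD^[k] Q)‖ ≤ Real.exp (-(N : ℝ) ^ u) := by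
  filter_upwards [hb, roy_no_exact_witness hy hα ht₀ ht₁ hsum htor] with N hN hN'
  refine ⟨hN, fun Q hQ hd0 hd1 hsmall => ?_⟩
  obtain ⟨k, m, hk, hm, hne⟩ := hN' Q hQ hd0 hd1
  exact ⟨k, m, hk, hm, norm_pos_iff.mpr hne, hsmall k m hk hm⟩

/-- **On the graph.** For `y ≠ 0`, `α = e^y` and parameters in the range of Roy's Proposition 2
(`max{1, s₀, t₀, s₁ + t₁} < u < (1 + t₀ + t₁)/2`, all positive) with `t₀ + t₁ < s₀ + s₁` and
`t₁ < s₀`: condition (b) HOLDS (Roy's Proposition 2, proved in the tree), and yet no witness family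
is exact — Waldschmidt's auxiliary polynomials are small on `ℤ·(y, e^y)` but never vanish on the
whole box. [cite: Roy2001, Prop. 2 and Thm. 1; Philippon1986, Thm. 2.1] -/
theorem royConditionB_graph_inexact {y : ℂ} (hy : y ≠ 0) {s₀ s₁ t₀ t₁ u : ℝ}
    (hs₀ : 0 < s₀) (hs₁ : 0 < s₁) (ht₀ : 0 < t₀) (ht₁ : 0 < t₁) (hu : 0 < u)
    (hlow : max 1 (max s₀ (max t₀ (s₁ + t₁))) < u) (hup : u < (1 + t₀ + t₁) / 2)
    (hsum : t₀ + t₁ < s₀ + s₁) (ht₁s₀ : t₁ < s₀) :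
    RoyConditionB y (cexp y) s₀ s₁ t₀ t₁ u ∧
      ∀ᶠ N : ℕ in atTop, ∀ Q : MvPolynomial (Fin 2) ℤ, Q ≠ 0 →
        (Q.degreeOf 0 : ℝ) ≤ (N : ℝ) ^ t₀ → (Q.degreeOf 1 : ℝ) ≤ (N : ℝ) ^ t₁ →
        ∃ k m : ℕ, (k : ℝ) ≤ (N : ℝ) ^ s₀ ∧ (m : ℝ) ≤ (N : ℝ) ^ s₁ ∧
          aeval ![(m : ℂ) * y, cexp y ^ m] (royD^[k] Q) ≠ 0 := by
  have hα : cexp y ≠ 0 := exp_ne_zero y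
  refine ⟨Roy2001_prop2_holds y (cexp y) hα s₀ s₁ t₀ t₁ u hs₀ hs₁ ht₀ ht₁ hu hlow hup
    ⟨1, le_rfl, by simp⟩, ?_⟩
  exact roy_no_exact_witness hy hα ht₀.le ht₁.le hsum (Or.inr ht₁s₀)

end Summit.Schanuel.Schanuel.Theorems

end
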